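import Summits.QuantumFields.GaugeBoot.TiltedSiteRPGeometry
import HarnessLib

/-!
# Site frames: plaquette classes and the plaquette reflection (gauge-boot, L3(τ) part 2)

HONEST FRAMING (cell `pub-gaugeboot`, page 1 of every file): the venture produces certified bounds
on lattice expectations at stated coupling, gauge group, dimension and torus size; NOT a mass gap,
NOT a continuum limit, NOT a string tension; NOT Yang–Mills-summit-bearing (barriers
`FixedCouplingUltralocality`, `PerturbativeInvisibility`).

Continuation of `TiltedSiteRPGeometry.lean` (site frame `IsSiteFrame e k θ P h` on a periodic
lattice: reflection `θ` in the lattice hyperplane orthogonal to the axis `k`, height `h`, `P ≥ 2`).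
Relative to the two layers `h = 0`, `h = P` NO plaquette is cut: a plaquette with a `k`-side based at
height `c` spans `c, c + 1` and is POSITIVE (`c + 1 ≤ P`) or negative; a plaquette without `k`-side
lies at one height and is positive (`1 ≤ c ≤ P - 1`), negative, or a MIRROR plaquette (inside a
layer). Contents: the classes `IsSitePosPlaq / IsSiteNegPlaq / IsSiteMirrorPlaq`; the plaquette
reflection `plaqReflect` (base point `θx`, lowered by `e_k` if the plaquette has a `k`-side,
directions unchanged) — an involution exchanging positive and negative plaquettes and fixing
mirror plaquettes; links of positive plaquettes are half links, of mirror plaquettes mirror links.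
Holonomies follow in `TiltedSiteRPHolonomy.lean`.

References: K. Osterwalder, E. Seiler, Ann. Phys. 110 (1978) 440, §2; J. Fröhlich, R. Israel,
E. H. Lieb, B. Simon, Comm. Math. Phys. 62 (1978) 1, Thm. 2.1.
-/

namespace Summit.QuantumFields.GaugeBoot

namespace TiltedRP

namespace IsSiteFrame

variable {A : Type*} [AddCommGroup A] {d : ℕ}
variable {e : Fin d → A} {k : Fin d} {θ : A →+ A} {P : ℕ} {h : A →+ ZMod (2 * P)}
variable (hF : IsSiteFrame e k θ P h)
include hF

/-! ## Plaquettes: classes and the reflection -/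

omit hF in
/-- A MIRROR plaquette: inside a layer (base in a layer, no `k`-side). -/
def IsSiteMirrorPlaq (k : Fin d) (P : ℕ) (h : A →+ ZMod (2 * P)) (p : Plaq A d) : Prop :=
  IsLayer P h p.1 ∧ ¬ HasDir p k

omit hF in
/-- A POSITIVE plaquette: all links in the closed half `{0 ≤ h ≤ P}`, not a mirror plaquette
(`c + 1 ≤ P`, and `1 ≤ c` if the plaquette has no `k`-side; `c` the base height). -/
def IsSitePosPlaq (k : Fin d) (P : ℕ) (h : A →+ ZMod (2 * P)) (p : Plaq A d) : Prop :=
  (¬ HasDir p k → 1 ≤ (h p.1).val) ∧ (h p.1).val + 1 ≤ P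

omit hF in
/-- A NEGATIVE plaquette: neither positive nor mirror. -/
def IsSiteNegPlaq (k : Fin d) (P : ℕ) (h : A →+ ZMod (2 * P)) (p : Plaq A d) : Prop :=
  ¬ IsSitePosPlaq k P h p ∧ ¬ IsSiteMirrorPlaq k P h p

omit hF in
/-- The reflected plaquette: base point `θx`, lowered by `e_k` if the plaquette has a `k`-side;
same directions. -/
def plaqReflect (e : Fin d → A) (k : Fin d) (θ : A →+ A) (p : Plaq A d) : Plaq A d :=
  (θ p.1 + (if p.2.1.1 = k ∨ p.2.1.2 = k then -e k else 0), p.2)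

omit hF in
/-- The base point of the reflected plaquette, with a `k`-side. -/
theorem plaqReflect_fst_of_hasDir {p : Plaq A d} (hp : HasDir p k) :
    (plaqReflect e k θ p).1 = θ p.1 - e k := by
  have hp' : p.2.1.1 = k ∨ p.2.1.2 = k := hp
  simp [plaqReflect, hp', sub_eq_add_neg]

omit hF in
/-- The base point of the reflected plaquette, without `k`-side. -/
theorem plaqReflect_fst_of_not_hasDir {p : Plaq A d} (hp : ¬ HasDir p k) :
    (plaqReflect e k θ p).1 = θ p.1 := by
  have hp' : ¬ (p.2.1.1 = k ∨ p.2.1.2 = k) := hp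
  simp [plaqReflect, hp']

omit hF in
/-- The reflected plaquette has the same directions. -/
@[simp] theorem plaqReflect_snd (p : Plaq A d) : (plaqReflect e k θ p).2 = p.2 := rfl

omit hF in
/-- `HasDir` is unchanged by the reflection. -/
theorem hasDir_plaqReflect (p : Plaq A d) (m : Fin d) : HasDir (plaqReflect e k θ p) m ↔ HasDir p m :=
  Iff.rfl

/-- `plaqReflect` is an involution. -/
@[simp] theorem plaqReflect_plaqReflect (p : Plaq A d) : plaqReflect e k θ (plaqReflect e k θ p) = p := by
  obtain ⟨x, q⟩ := p
  by_cases hp : HasDir (x, q) k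
  · have hp' : HasDir (plaqReflect e k θ (x, q)) k := hp
    ext1
    · rw [plaqReflect_fst_of_hasDir hp', plaqReflect_fst_of_hasDir hp]
      simp only
      rw [hF.map_sub_self, hF.invol, add_sub_cancel_right]
    · rfl
  · have hp' : ¬ HasDir (plaqReflect e k θ (x, q)) k := hp
    ext1
    · rw [plaqReflect_fst_of_not_hasDir hp', plaqReflect_fst_of_not_hasDir hp]
      exact hF.invol x
    · rfl

/-- Positive and mirror are exclusive. -/
theorem not_isSiteMirrorPlaq_of_isSitePosPlaq {p : Plaq A d} (hp : IsSitePosPlaq k P h p) :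
    ¬ IsSiteMirrorPlaq k P h p := by
  rintro ⟨hl, hK⟩
  have hl' := (hF.layer_iff_val p.1).1 hl
  obtain ⟨h1, h2⟩ := hp
  have hP := hF.two_le
  have := h1 hK
  omega

/-- `plaqReflect` preserves the mirror plaquettes. -/
theorem isSiteMirrorPlaq_plaqReflect_iff (p : Plaq A d) :
    IsSiteMirrorPlaq k P h (plaqReflect e k θ p) ↔ IsSiteMirrorPlaq k P h p := by
  unfold IsSiteMirrorPlaq IsLayer
  rw [hasDir_plaqReflect]
  by_cases hp : HasDir p k
  · simp [hp]
  · rw [plaqReflect_fst_of_not_hasDir hp, hF.layer_map_iff]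

/-- **`plaqReflect` carries negative plaquettes to positive ones.** -/
theorem isSitePosPlaq_plaqReflect_iff (p : Plaq A d) :
    IsSitePosPlaq k P h (plaqReflect e k θ p) ↔ IsSiteNegPlaq k P h p := by
  have hP := hF.two_le
  have hc := val_lt_two_mul hP (h p.1)
  have hlay := hF.layer_iff_val p.1
  unfold IsSiteNegPlaq IsSitePosPlaq IsSiteMirrorPlaq IsLayer
  rw [hasDir_plaqReflect, hlay]
  by_cases hK : HasDir p k
  · rw [plaqReflect_fst_of_hasDir hK, hF.val_height_map_sub]
    simp only [hK, not_true_eq_false, false_implies, true_and, and_false, not_false_eq_true,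
      and_true, not_le]
    omega
  · rw [plaqReflect_fst_of_not_hasDir hK, hF.val_height_map]
    simp only [hK, not_false_eq_true, true_implies, and_true]
    split_ifs with h0 <;> omega

/-- `plaqReflect` carries positive plaquettes to negative ones. -/
theorem isSiteNegPlaq_plaqReflect_iff (p : Plaq A d) :
    IsSiteNegPlaq k P h (plaqReflect e k θ p) ↔ IsSitePosPlaq k P h p := by
  rw [← hF.isSitePosPlaq_plaqReflect_iff, hF.plaqReflect_plaqReflect]

/-- Mirror plaquettes are fixed by `plaqReflect`. -/
theorem plaqReflect_of_isSiteMirrorPlaq {p : Plaq A d} (hp : IsSiteMirrorPlaq k P h p) :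
    plaqReflect e k θ p = p := by
  obtain ⟨x, q⟩ := p
  obtain ⟨h1, h2⟩ := hp
  ext1
  · rw [plaqReflect_fst_of_not_hasDir h2]
    exact hF.map_of_isLayer h1
  · rfl

/-! ## The links of positive and mirror plaquettes -/

/-- A `k`-link based at height `c` with `c + 1 ≤ P` is a half link. -/
theorem isHalfLink_self {y : A} (hy : (h y).val + 1 ≤ P) : IsHalfLink e P h (y, k) := by
  have hP := hF.two_le
  refine ⟨?_, ?_⟩ <;> unfold InHalf <;> simp only
  · omega
  · rw [hF.val_height_add_self, if_neg (by omega)]; exact hy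

/-- An `l`-link, `l ≠ k`, based in the closed half is a half link. -/
theorem isHalfLink_other {y : A} {l : Fin d} (hl : l ≠ k) (hy : (h y).val ≤ P) :
    IsHalfLink e P h (y, l) := by
  refine ⟨?_, ?_⟩ <;> unfold InHalf <;> simp only
  · exact hy
  · rw [hF.height_add_other y hl]; exact hy

/-- **All four links of a positive plaquette are links of the closed half.** -/
theorem isHalfLink_of_isSitePosPlaq {p : Plaq A d} (hp : IsSitePosPlaq k P h p) :
    IsHalfLink e P h (p.1, p.2.1.1) ∧ IsHalfLink e P h (p.1 + e p.2.1.1, p.2.1.2) ∧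
      IsHalfLink e P h (p.1 + e p.2.1.2, p.2.1.1) ∧ IsHalfLink e P h (p.1, p.2.1.2) := by
  obtain ⟨x, ⟨⟨l, m⟩, hlm⟩⟩ := p
  have hP := hF.two_le
  have hlm' : l ≠ m := ne_of_lt hlm
  obtain ⟨h1, h2⟩ := hp
  simp only [HasDir] at h1 h2 ⊢
  have hk : (h (x + e k)).val = (h x).val + 1 := by rw [hF.val_height_add_self, if_neg (by omega)]
  by_cases hl : l = k
  · subst hl
    have hm : m ≠ l := fun h' => hlm' h'.symm
    have ho : h (x + e m) = h x := hF.height_add_other x hm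
    exact ⟨hF.isHalfLink_self h2, hF.isHalfLink_other hm (by rw [hk]; exact h2),
      hF.isHalfLink_self (by rw [ho]; exact h2), hF.isHalfLink_other hm (by omega)⟩
  · by_cases hm : m = k
    · subst hm
      have ho : h (x + e l) = h x := hF.height_add_other x hl
      exact ⟨hF.isHalfLink_other hl (by omega), hF.isHalfLink_self (by rw [ho]; exact h2),
        hF.isHalfLink_other hl (by rw [hk]; exact h2), hF.isHalfLink_self h2⟩
    · have hol : h (x + e l) = h x := hF.height_add_other x hl
      have hom : h (x + e m) = h x := hF.height_add_other x hm
      exact ⟨hF.isHalfLink_other hl (by omega), hF.isHalfLink_other hm (by rw [hol]; omega),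
        hF.isHalfLink_other hl (by rw [hom]; omega), hF.isHalfLink_other hm (by omega)⟩

/-- **All four links of a mirror plaquette are mirror links.** -/
theorem isMirrorLink_of_isSiteMirrorPlaq {p : Plaq A d} (hp : IsSiteMirrorPlaq k P h p) :
    IsMirrorLink k k P h (p.1, p.2.1.1) ∧ IsMirrorLink k k P h (p.1 + e p.2.1.1, p.2.1.2) ∧
      IsMirrorLink k k P h (p.1 + e p.2.1.2, p.2.1.1) ∧ IsMirrorLink k k P h (p.1, p.2.1.2) := by
  obtain ⟨x, ⟨⟨l, m⟩, hlm⟩⟩ := p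
  obtain ⟨h1, h2⟩ := hp
  simp only [HasDir, not_or] at h1 h2
  unfold IsMirrorLink IsLayer
  simp only
  rw [hF.height_add_other x h2.1, hF.height_add_other x h2.2]
  unfold IsLayer at h1
  exact ⟨⟨h1, h2.1, h2.1⟩, ⟨h1, h2.2, h2.2⟩, ⟨h1, h2.1, h2.1⟩, ⟨h1, h2.2, h2.2⟩⟩

end IsSiteFrame

end TiltedRP

end Summit.QuantumFields.GaugeBoot
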